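import Literature.RingTheory.KTheory.MilnorKRing
import Literature.RingTheory.KTheory.TameSymbol
import HarnessLib

/-!
# The tame symbol `∂_v : K_nF → K_{n−1}F̄` and the specialisation `ψ_π : K_*F → K_*F̄` of a discrete valuation
# (Milnor, *Algebraic K-theory and quadratic forms*, Invent. Math. 9 (1970), §2, Lemmas 2.1 and 2.2)

Family `hodge`, lane `lit-hodgefound` (foundations library; seat `lit-hodgefound-p27`, generation 40, row g40-#1);
topic `RingTheory/KTheory`.  Sequel of `MilnorKGroups` / `MilnorKRing` (g39-#12/#14: Milnor's groups `MilnorK R n`,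
`symbol`, `lift`, `cons`, the graded product `mul` and Lemmas 1.1–1.3) and of `TameSymbol` (g30-#5: the dictionary
`addVal`, `unitOfEqOne`, `residueUnitHom` of a valuation `v : Valuation F ℤₘ₀` and Lemma 11.5 of the book, the tame
symbol `tameSymbolOf v`).  DEFINITIONS WITH BODIES (`consAddHom`, `thetaStep`, `thetaBase`, `ValResidueField`,
`unitPartOf`, `res`, `thetaStepOf`, `thetaBaseOf`, `thetaSuccCurried`, `theta`, `thetaHom`, `psiZero`, `psi`,
`boundary`, `primeUnitSymbols`) and PROVED THEOREMS; no named fact, no instance, no notation, 0 `sorry`, net debt 0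
(D-0026).

## The source, verbatim

J. Milnor, *Algebraic K-theory and quadratic forms*, Invent. Math. 9 (1970) 318–344 (held `paper:doi-10-1007-bf01425486`;
bib key `Milnor1970`), §2 «Discrete Valuations and the Computation of K_*F(t)» (p0005 L31 – p0007 L51):
«Suppose that a field F has a discrete valuation v with residue class field F̄ (= π̄). The group of units (elements u
with ord_v u = 0) will be denoted by U, and the natural homomorphism U → F̄• by u ↦ ū. An element π of F• is prime if
ord_v π = 1.
**LEMMA 2.1.** There exists one and only one homomorphism ∂ = ∂_v from K_nF to K_{n−1}F̄ which carries the product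
l(π)l(u₂)⋯l(uₙ) to l(ū₂)⋯l(ūₙ) for every prime element π and for all units u₂, …, uₙ. This homomorphism ∂ annihilates
every product of the form l(u₁)⋯l(uₙ). (For n = 1 the defining property is to be that ∂l(π) = 1.)
*Remarks.* Evidently ∂ is always surjective. For n = 1 the homomorphism ∂ can essentially be identified with the
homomorphism ord_v : F• → ℤ, and for n = 2 it is closely related to the classical "tame symbol" […].
To begin the proof, note that any unit u₁ can be expressed as the quotient πu₁/π of two prime elements. So the
property ∂(l(u₁)⋯l(uₙ)) = 0 follows immediately from the defining equation.
*Proof of Uniqueness.* Choose a prime element π. Since F• is generated by π and U, it follows that K_nF is generated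
by products of the form l(π)^r l(u_{r+1})⋯l(uₙ). If r = 1, then the image of any such product under ∂ has been
specified; and if r > 1 then using the identity l(π)^r = l(π)l(−1)^{r−1} it is also specified. But if r = 0, then any
such product maps to zero. This proves that ∂ is unique, if it exists.
*Proof of Existence¹.* It will be convenient to introduce an indeterminate symbol x which is to anticommute with all
elements of K₁F̄. Given any n-tuple of elements l(π^{i₁}u₁), …, l(π^{iₙ}uₙ) ∈ K₁F, construct a sequence of elements
φⱼ ∈ KⱼF̄ by the formula (x i₁ + l(ū₁))⋯(x iₙ + l(ūₙ)) = xⁿφ₀ + x^{n−1}φ₁ + ⋯ + φₙ. […] If two successive π^{iⱼ}uⱼ add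
up to 1, we will prove that φ = 0. […] To avoid complicated notation, we will carry out details only for the case
π^{i₁}u₁ + π^{i₂}u₂ = 1. There are four possibilities to consider. If i₁ > 0, then it follows easily that i₂ = 0,
ū₂ = 1. Hence the factor x i₂ + l(ū₂) is zero and it certainly follows that φ = 0. The case i₁ = 0, i₂ > 0 is
disposed of similarly. If i₁ = i₂ = 0, then ū₁ + ū₂ = 1, hence (x i₁ + l(ū₁))(x i₂ + l(ū₂)) = 0, so again φ = 0.
Finally suppose that i₁ < 0. Then clearly i₁ = i₂ and ū₂ = −ū₁. In this case the product
(x i₁ + l(ū₁))(x i₂ + l(ū₂)) evidently simplifies to x² i₁² + x i₁ l(−1) + 0. […] But this substitution carries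
x i₂ + i₁ l(−1) to l(−1) i₁ + i₁ l(−1) = 0. So φ = 0 in this case also; which completes the proof of 2.1.
¹ *Added in Proof.* A much better construction of the homomorphism ∂ has been suggested by Serre. Adjoin to the ring
K_*F̄ a new symbol ξ of degree 1 which is to anticommute with the elements of K₁F̄, and to satisfy the identity
ξ² = ξ l(−1), but is to satisfy no other relations. Thus the enlarged ring (K_*F̄)[ξ] is free over K_*F̄ with basis
{1, ξ}. It is not difficult to show that the correspondence l(πⁱu) ↦ iξ + l(ū) extends uniquely to a ring homomorphism
θ_π from K_*F to this enlarged ring. Now, setting θ_π(α) = ψ(α) + ξ∂(α) with ψ(α) and ∂(α) in K_*F̄, we obtain the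
required homomorphism ∂.
A similar argument proves the following. **LEMMA 2.2.** Choosing some fixed prime element π, there is one and only one
ring homomorphism ψ : K_*F → K_*F̄ which carries l(πⁱu) to l(ū) for every unit u. In fact ψ is defined by the rule
l(π^{i₁}u₁)⋯l(π^{iₙ}uₙ) ↦ l(ū₁)⋯l(ūₙ). Details will be left to the reader. Evidently this homomorphism ψ is less
natural than ∂, since it depends on a particular choice of π.»

## What is formalised

The valuation is Mathlib's `v : Valuation F ℤₘ₀` with the dictionary of `TameSymbol` (Milnor's `ord_v = addVal v`,
`U = v.valuationSubring.unitGroup`, `F̄ = ValResidueField v` — the residue field of the valuation ring — and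
`u ↦ ū = residueUnitHom v`); «discrete» enters as the datum of a prime element `π` (`hπ : addVal v π = 1`), which the
constructions take as a parameter and the results show to be immaterial (`boundary_eq_boundary`).  Existence follows
the paper: Serre's ring `(K_*F̄)[ξ]` is used as BOOKKEEPING ONLY — writing `θ_π(α) = ψ(α) + ξ∂(α)` with `ξ` on the
left, the rule `θ(l(a)·η) = (iξ + l(ū))·θ(η)` (`a = πⁱu`, `ξl(ū) = −l(ū)ξ`, `ξ² = ξl(−1)`) reads
`ψ(l(a)η) = l(ū)ψ(η)`, `∂(l(a)η) = iψ(η) + i l(−1)∂(η) − l(ū)∂(η)`; this degree-wise recursion (`thetaStep`) is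
exactly Milnor's `n`-linear expansion `(x i₁ + l(ū₁))⋯(x iₙ + l(ūₙ))`, and the Steinberg relation is checked through
his FOUR CASES (`thetaStep_thetaStep_eq_zero_of_cases`, `rel_cases`), so no ring structure on pairs is needed.
* §0 the `cons`-calculus in `K_*` used throughout (from `MilnorKGroups` by additivity): `cons_mul/one/inv/zpow`
  (`consAddHom`), `even_smul_cons_neg_one` (`2l(−1) = 0`), `cons_cons_eq_zero_of_add_eq_one` (`l(x)l(1−x)η = 0`),
  `cons_cons_neg_self` (`l(x)l(−x)η = 0`), `cons_cons_comm` (Lemma 1.1), `cons_neg`.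
* §1 the step `thetaStep n i u : K_{n+1}F̄ × K_nF̄ → K_{n+2}F̄ × K_{n+1}F̄`, `(ψ, ∂) ↦ (l(u)ψ, iψ + i l(−1)∂ − l(u)∂)`,
  its additivity in `(i, u)` (`thetaStep_add_mul`) and **the four cases** `thetaStep_thetaStep_zero_one` (i₁ > 0),
  `thetaStep_zero_one_thetaStep` (i₂ > 0), `thetaStep_thetaStep_of_add_eq_one` (ū₁ + ū₂ = 1), `thetaStep_thetaStep_neg`
  (i₁ = i₂, ū₂ = −ū₁: the coefficients `i(i+1) l(−1)`, `i(i−1) l(−1)l(−1)` vanish), and the same for the base pair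
  `thetaBase i u = ({u}, i·1) ∈ K₁F̄ × K₀F̄` (`thetaStep_thetaBase_eq_zero_of_cases`).
* §2 the valuation side: `unitPartOf v hπ : F• →* U` (`x ↦ xπ^{−v(x)}`), **`res v hπ : F• →* F̄•`** (`x = πⁱu ↦ ū`;
  `res_of_addVal_eq_zero` — on units it is `u ↦ ū`, `res_pi`, `res_neg_one`, `res_neg`), `coe_residueUnitHom_add_eq_one`,
  and **`rel_cases`**: `x + y = 1` forces one of Milnor's four cases (from `TameSymbol`'s
  `addVal_eq_zero_and_residue_eq_one_of_pos` / `addVal_eq_and_eq_neg_mul_of_neg`).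
* §3 the recursion `theta v hπ n : (K₁F)^{n+1} → K_{n+1}F̄ × K_nF̄` (multilinear, via `LinearMap.uncurryLeft`),
  **`theta_eq_zero_of_add_eq_one`** (it kills the Steinberg relations), the descent **`thetaHom v hπ n : K_{n+1}F →+
  K_{n+1}F̄ × K_nF̄`** (`lift`), `thetaHom_succ_cons`.
* §4 **`psi v hπ n : K_nF →+ K_nF̄`** and **`boundary v hπ n : K_{n+1}F →+ K_nF̄`** with the recursions `psi_cons`,
  `boundary_cons`; **`psi_symbol`** («ψ is defined by the rule l(π^{i₁}u₁)⋯l(π^{iₙ}uₙ) ↦ l(ū₁)⋯l(ūₙ)»);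
  **`boundary_symbol_eq_zero_of_units`** («∂ annihilates every product l(u₁)⋯l(uₙ)»);
  **`boundary_symbol_cons_units`** («carries l(π)l(u₂)⋯l(uₙ) to l(ū₂)⋯l(ūₙ) for EVERY prime element π»).
* §5 uniqueness («K_nF is generated by products l(π)^r l(u_{r+1})⋯l(uₙ) … l(π)^r = l(π)l(−1)^{r−1}»):
  `symbol_eq_symbol_update_neg_one` (Lemma 1.2 at non-adjacent slots), the generating set `primeUnitSymbols v n` of the
  `{π′, u₂, …, u_{n+1}}`, **`closure_primeUnitSymbols`** (`= ⊤`), `hom_ext_primeUnitSymbols`, **`boundary_unique`**,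
  **LEMMA 2.1 `existsUnique_boundary`**, and `boundary_eq_boundary` (independence of `π`).
* §6 the Remarks: **`boundary_surjective`**; `n = 1`: **`zeroEquiv_boundary_symbol`** (`∂{a} = ord_v a`),
  `boundary_zero_symbol_prime` («∂l(π) = 1»); `n = 2`: **`oneEquiv_boundary_symbol`** (`∂{x, y} = l(d_v(y, x))` with the
  book's tame symbol `tameSymbolOf v` of Lemma 11.5 — «closely related to the classical tame symbol»).
* §7 LEMMA 2.2: `psi_one'` (`ψ(1) = 1`), **`psi_mul`** (`ψ(ξη) = ψ(ξ)ψ(η)` for the graded product `mul` of `MilnorKRing`),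
  and uniqueness **`psi_unique`** (a unital multiplicative family with `f{a} = {ā}` in degree `1` is `ψ`).

Not here: `K_nF(t)` (Theorem 2.3, Lemmas 2.4–2.5 — the sequel rows g40-#2/#3), Lemma 2.6 (complete fields mod `p`).

## References

* [Milnor1970] J. Milnor, *Algebraic K-theory and quadratic forms*, Invent. Math. 9 (1970) 318–344 — §2: Lemma 2.1
  (p0005 L36–L40), Remarks (p0005 L42 – p0006 L7), proof of 2.1 (p0006 L8 – p0007 L37) with Serre's footnote
  (p0006 L38–L46), Lemma 2.2 (p0007 L39–L51); §1 Lemmas 1.1/1.2 (p0002 L33–L50).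
* [Milnor1972] J. Milnor, *Introduction to Algebraic K-Theory*, Annals of Mathematics Studies 72 (Princeton 1971) —
  §11 Lemma 11.5 (the tame symbol `d_v`; tree `TameSymbol`).

Provenance: lane `lit-hodgefound`, seat `lit-hodgefound-p27` gen 40 (agent `literature-prover-lit-hodgefound-p27-g40-0`),
row g40-#1.
-/

set_option autoImplicit false

noncomputable section

namespace Literature.RingTheory.KTheory

namespace MilnorK

open Function

/-! ### §0 The `cons`-calculus: left multiplication by `l(x)` in `K_*` -/

section ConsCalculus

variable {R : Type*} [CommRing R] {n : ℕ}

/-- `(y, a) = (x, a)` updated at slot `0`. [cite: Milnor1970, §1 «l(a₁) ⊗ ⋯ ⊗ l(aₙ)» (p0002 L16–L18)] -/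
theorem cons_eq_update_cons (x y : Rˣ) (a : Fin n → Rˣ) :
    (Fin.cons y a : Fin (n + 1) → Rˣ) = update (Fin.cons x a : Fin (n + 1) → Rˣ) 0 y := by
  rw [Fin.update_cons_zero]

/-- `l(xy)·{a} = l(x)·{a} + l(y)·{a}`. [cite: Milnor1970, §1 «l(ab) = l(a) + l(b)» (p0002 L19–L21)] -/
theorem cons_mul_symbol (x y : Rˣ) (a : Fin n → Rˣ) :
    cons (x * y) (symbol a) = cons x (symbol a) + cons y (symbol a) := by
  rw [cons_symbol, cons_symbol, cons_symbol, cons_eq_update_cons x (x * y), symbol_update_mul,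
    ← cons_eq_update_cons, ← cons_eq_update_cons]

/-- **`l(xy)·z = l(x)·z + l(y)·z`.** [cite: Milnor1970, §1 «l(ab) = l(a) + l(b)» (p0002 L19–L21)] -/
theorem cons_mul (x y : Rˣ) (z : MilnorK R n) : cons (x * y) z = cons x z + cons y z := by
  have h : cons (n := n) (x * y) = cons x + cons y := hom_ext fun a => by
    rw [AddMonoidHom.add_apply, cons_mul_symbol]
  rw [h, AddMonoidHom.add_apply]

/-- `l(1)·z = 0`. [cite: Milnor1970, §1 «l(ab) = l(a) + l(b)» (p0002 L19–L21)] -/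
theorem cons_one (z : MilnorK R n) : cons (1 : Rˣ) z = 0 := by
  have h : cons (n := n) (1 : Rˣ) = 0 := hom_ext fun a => by
    rw [cons_symbol, AddMonoidHom.zero_apply]
    exact symbol_eq_zero_of_eq_one _ 0 rfl
  rw [h, AddMonoidHom.zero_apply]

variable (R n) in
/-- Left multiplication `l(x)·(−) : K_nR → K_{n+1}R` as an additive function of `l(x) ∈ K₁R`.
[cite: Milnor1970, §1 «l(ab) = l(a) + l(b)» (p0002 L19–L21)] -/
def consAddHom : Additive Rˣ →+ (MilnorK R n →+ MilnorK R (n + 1)) :=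
  AddMonoidHom.mk' (fun x => cons (Additive.toMul x)) fun x y => AddMonoidHom.ext fun z => by
    rw [toMul_add, AddMonoidHom.add_apply]; exact cons_mul _ _ z

/-- The value of `consAddHom`. [cite: Milnor1970, §1 (p0002 L19–L21)] -/
theorem consAddHom_apply (x : Additive Rˣ) (z : MilnorK R n) : consAddHom R n x z = cons (Additive.toMul x) z := rfl

/-- `consAddHom (l x) = cons x`. [cite: Milnor1970, §1 (p0002 L19–L21)] -/
theorem consAddHom_ofMul (x : Rˣ) : consAddHom R n (Additive.ofMul x) = cons x := rfl

/-- `l(x⁻¹)·z = −l(x)·z`. [cite: Milnor1970, §1 «l(ab) = l(a) + l(b)» (p0002 L19–L21)] -/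
theorem cons_inv (x : Rˣ) (z : MilnorK R n) : cons x⁻¹ z = -cons x z := by
  rw [← consAddHom_ofMul, ofMul_inv, map_neg, AddMonoidHom.neg_apply, consAddHom_ofMul]

/-- `l(xᵏ)·z = k·l(x)·z` («the identity l(π)^r = l(π)l(−1)^{r−1}» is used through this multilinearity).
[cite: Milnor1970, §1 (p0002 L19–L21), §2 proof of uniqueness (p0006 L14–L18)] -/
theorem cons_zpow (x : Rˣ) (k : ℤ) (z : MilnorK R n) : cons (x ^ k) z = k • cons x z := by
  rw [← consAddHom_ofMul, ofMul_zpow, map_zsmul, AddMonoidHom.zsmul_apply, consAddHom_ofMul]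

/-- `2·l(−1)·z = 0` (`l(1) = 0`). [cite: Milnor1970, §1 proof of Theorem 1.4 «Since 2l(−1) = 0» (p0003 L45)] -/
theorem two_smul_cons_neg_one (z : MilnorK R n) : (2 : ℤ) • cons (-1 : Rˣ) z = 0 := by
  rw [← cons_zpow, show ((-1 : Rˣ) ^ (2 : ℤ)) = 1 by rw [zpow_two, neg_one_mul, neg_neg], cons_one]

/-- `k·l(−1)·z = 0` for even `k`. [cite: Milnor1970, §1 proof of Theorem 1.4 «Since 2l(−1) = 0» (p0003 L45)] -/
theorem even_smul_cons_neg_one {k : ℤ} (hk : Even k) (z : MilnorK R n) : k • cons (-1 : Rˣ) z = 0 := by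
  obtain ⟨j, rfl⟩ := hk
  rw [← two_mul, mul_comm, mul_zsmul, two_smul_cons_neg_one, zsmul_zero]

/-- **`l(x)l(y)·z = 0` when `x + y = 1`** (the Steinberg relation in the two front slots, any `z`).
[cite: Milnor1970, §1 «l(a)l(1−a) = 0» (p0002 L21)] -/
theorem cons_cons_eq_zero_of_add_eq_one (x y : Rˣ) (h : (x : R) + y = 1) (z : MilnorK R n) :
    cons x (cons y z) = 0 := by
  induction z using induction_on with
  | hsym k a =>
    rw [map_zsmul, map_zsmul, cons_symbol, cons_symbol, symbol_eq_zero_of_add_eq_one _ 0 (by simp) ?_, zsmul_zero]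
    exact h
  | hadd x' y' hx hy => rw [map_add, map_add, hx, hy, add_zero]

end ConsCalculus

section ConsField

variable {F : Type*} [Field F] {n : ℕ}

/-- **`l(x)l(−x)·z = 0`** (Lemma 1.1's first step, any `z`). [cite: Milnor1970, §1 proof of Lemma 1.1 «l(a)l(−a) = 0» (p0002 L37–L40)] -/
theorem cons_cons_neg_self (x : Fˣ) (z : MilnorK F n) : cons x (cons (-x) z) = 0 := by
  induction z using induction_on with
  | hsym k a =>
    rw [map_zsmul, map_zsmul, cons_symbol, cons_symbol, symbol_eq_zero_of_eq_neg _ 0 (by simp) ?_, zsmul_zero]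
    rfl
  | hadd x' y' hx hy => rw [map_add, map_add, hx, hy, add_zero]

/-- **`l(y)l(x)·z = −l(x)l(y)·z`** (Lemma 1.1 in the two front slots). [cite: Milnor1970, §1 Lemma 1.1 (p0002 L33–L45)] -/
theorem cons_cons_comm (x y : Fˣ) (z : MilnorK F n) : cons y (cons x z) = -cons x (cons y z) := by
  induction z using induction_on with
  | hsym k a =>
    rw [map_zsmul, map_zsmul, map_zsmul, map_zsmul, cons_symbol, cons_symbol, cons_symbol, cons_symbol,
      ← cons_cons_comp_swap x y a, symbol_comp_swap_of_ne _ Fin.zero_ne_one, zsmul_neg]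
  | hadd x' y' hx hy => rw [map_add, map_add, map_add, map_add, hx, hy, neg_add]

/-- `l(−x)·z = l(−1)·z + l(x)·z`. [cite: Milnor1970, §1 proof of Lemma 1.2 «l(−1) + l(−a)» (p0002 L48–L50)] -/
theorem cons_neg (x : Fˣ) (z : MilnorK F n) : cons (-x) z = cons (-1) z + cons x z := by
  rw [← cons_mul, neg_one_mul]

end ConsField

/-! ### §1 The step `(ψ, ∂) ↦ (l(u)ψ, iψ + i l(−1)∂ − l(u)∂)` and Milnor's four cases -/

section Step

variable {κ : Type*} [Field κ] {n : ℕ}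

variable (n) in
/-- **The step of the recursion**: multiplying `θ(η) = ψ + ξ∂` on the left by `θ(l(πⁱu)) = iξ + l(u)` in Serre's ring
`(K_*F̄)[ξ]` (`ξl(u) = −l(u)ξ`, `ξ² = ξl(−1)`) gives `(l(u)ψ) + ξ(iψ + i l(−1)∂ − l(u)∂)`; as a map of the pair:
`G(i, u)(ψ, ∂) = (l(u)ψ, iψ + i·l(−1)∂ − l(u)∂)` — one factor `(x iⱼ + l(ūⱼ))` of Milnor's expansion.
[cite: Milnor1970, §2 proof of Lemma 2.1 «(x i₁ + l(ū₁))⋯(x iₙ + l(ūₙ)) = xⁿφ₀ + ⋯ + φₙ» (p0006 L19–L30) and footnote ¹ (p0006 L38–L46)] -/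
def thetaStep (i : ℤ) (u : κˣ) : MilnorK κ (n + 1) × MilnorK κ n →+ MilnorK κ (n + 2) × MilnorK κ (n + 1) :=
  AddMonoidHom.prod
    ((cons u).comp (AddMonoidHom.fst _ _))
    (i • AddMonoidHom.fst _ _ + i • (cons (-1)).comp (AddMonoidHom.snd _ _) - (cons u).comp (AddMonoidHom.snd _ _))

/-- The value of the step. [cite: Milnor1970, §2 proof of Lemma 2.1 (p0006 L19–L30, L38–L46)] -/
theorem thetaStep_apply (i : ℤ) (u : κˣ) (ψ : MilnorK κ (n + 1)) (d : MilnorK κ n) :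
    thetaStep n i u (ψ, d) = (cons u ψ, i • ψ + i • cons (-1) d - cons u d) := rfl

/-- First component of the step: `l(u)ψ`. [cite: Milnor1970, §2 proof of Lemma 2.1 (p0006 L19–L30, L38–L46)] -/
theorem thetaStep_fst (i : ℤ) (u : κˣ) (p : MilnorK κ (n + 1) × MilnorK κ n) :
    (thetaStep n i u p).1 = cons u p.1 := rfl

/-- Second component of the step: `iψ + i l(−1)∂ − l(u)∂`. [cite: Milnor1970, §2 proof of Lemma 2.1 (p0006 L19–L30, L38–L46)] -/
theorem thetaStep_snd (i : ℤ) (u : κˣ) (p : MilnorK κ (n + 1) × MilnorK κ n) :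
    (thetaStep n i u p).2 = i • p.1 + i • cons (-1) p.2 - cons u p.2 := rfl

/-- The step is additive in `(i, u)`: «each φⱼ is n-linear as a function of l(π^{i₁}u₁), …, l(π^{iₙ}uₙ)».
[cite: Milnor1970, §2 proof of Lemma 2.1 (p0006 L27)] -/
theorem thetaStep_add_mul (i j : ℤ) (u w : κˣ) :
    thetaStep n (i + j) (u * w) = thetaStep n i u + thetaStep n j w := by
  refine AddMonoidHom.ext fun p => Prod.ext ?_ ?_
  · rw [AddMonoidHom.add_apply, Prod.fst_add, thetaStep_fst, thetaStep_fst, thetaStep_fst, cons_mul]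
  · rw [AddMonoidHom.add_apply, Prod.snd_add, thetaStep_snd, thetaStep_snd, thetaStep_snd, cons_mul, add_smul, add_smul]
    abel

/-- The step at `l(1)` (`i = 0`, `u = 1`) is zero: «the factor x i₂ + l(ū₂) is zero». [cite: Milnor1970, §2 proof of Lemma 2.1 (p0007 L14–L20)] -/
theorem thetaStep_zero_one : thetaStep n 0 (1 : κˣ) = 0 := by
  refine AddMonoidHom.ext fun p => Prod.ext ?_ ?_
  · rw [thetaStep_fst, cons_one]; rfl
  · rw [thetaStep_snd, cons_one, zero_smul, zero_smul]; simp

/-- **Case «i₁ > 0»: then `i₂ = 0`, `ū₂ = 1`, «the factor x i₂ + l(ū₂) is zero and it certainly follows that φ = 0».**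
[cite: Milnor1970, §2 proof of Lemma 2.1 (p0007 L14–L20)] -/
theorem thetaStep_thetaStep_zero_one (i : ℤ) (u : κˣ) (p : MilnorK κ (n + 1) × MilnorK κ n) :
    thetaStep (n + 1) i u (thetaStep n 0 1 p) = 0 := by
  rw [thetaStep_zero_one, AddMonoidHom.zero_apply, map_zero]

/-- **Case «i₁ = 0, i₂ > 0» «is disposed of similarly»** (now the first factor is zero). [cite: Milnor1970, §2 proof of Lemma 2.1 (p0007 L21)] -/
theorem thetaStep_zero_one_thetaStep (i : ℤ) (u : κˣ) (p : MilnorK κ (n + 1) × MilnorK κ n) :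
    thetaStep (n + 1) 0 1 (thetaStep n i u p) = 0 := by
  rw [thetaStep_zero_one, AddMonoidHom.zero_apply]

/-- **Case «i₁ = i₂ = 0»: «then ū₁ + ū₂ = 1, hence (x i₁ + l(ū₁))(x i₂ + l(ū₂)) = 0, so again φ = 0».**
[cite: Milnor1970, §2 proof of Lemma 2.1 (p0007 L22–L24)] -/
theorem thetaStep_thetaStep_of_add_eq_one (u w : κˣ) (h : (u : κ) + w = 1) (p : MilnorK κ (n + 1) × MilnorK κ n) :
    thetaStep (n + 1) 0 u (thetaStep n 0 w p) = 0 := by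
  refine Prod.ext ?_ ?_
  · rw [thetaStep_fst, thetaStep_fst, cons_cons_eq_zero_of_add_eq_one u w h]; rfl
  · rw [thetaStep_snd, thetaStep_fst, thetaStep_snd, zero_smul, zero_smul, zero_add, zero_smul, zero_smul, zero_add,
      zero_sub, zero_sub, map_neg, cons_cons_eq_zero_of_add_eq_one u w h, neg_zero, neg_zero]; rfl

/-- **Case «i₁ < 0»: «then clearly i₁ = i₂ and ū₂ = −ū₁. In this case the product (x i₁ + l(ū₁))(x i₂ + l(ū₂))
evidently simplifies to x²i₁² + x i₁ l(−1) + 0 … this substitution carries x i₂ + i₁ l(−1) to l(−1)i₁ + i₁l(−1) = 0».**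
Here: the surviving coefficients are `i(i+1)·l(−1)ψ` and `i(i−1)·l(−1)l(−1)∂`, both even multiples of `l(−1)`.
[cite: Milnor1970, §2 proof of Lemma 2.1 (p0007 L25–L37)] -/
theorem thetaStep_thetaStep_neg (i : ℤ) (u : κˣ) (p : MilnorK κ (n + 1) × MilnorK κ n) :
    thetaStep (n + 1) i u (thetaStep n i (-u) p) = 0 := by
  obtain ⟨ψ, d⟩ := p
  refine Prod.ext ?_ ?_
  · rw [thetaStep_fst, thetaStep_fst, cons_cons_neg_self]; rfl
  · rw [thetaStep_snd, thetaStep_fst, thetaStep_snd]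
    show i • cons (-u) ψ + i • cons (-1) (i • ψ + i • cons (-1) d - cons (-u) d) - cons u (i • ψ + i • cons (-1) d - cons (-u) d) = 0
    rw [map_sub, map_add, map_zsmul, map_zsmul, map_sub, map_add, map_zsmul, map_zsmul, cons_cons_neg_self,
      cons_cons_comm (-1 : κˣ) u, cons_neg u ψ, cons_neg u d, map_add]
    have h1 : (i * i + i) • cons (-1 : κˣ) ψ = 0 := by
      have he : Even (i * i + i) := by rw [← mul_add_one]; exact Int.even_mul_succ_self i
      exact even_smul_cons_neg_one he _
    have h2 : (i * i - i) • cons (-1 : κˣ) (cons (-1 : κˣ) d) = 0 := by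
      have he : Even (i * i - i) := by rw [← mul_sub_one]; exact Int.even_mul_pred_self i
      exact even_smul_cons_neg_one he _
    rw [add_smul, mul_smul] at h1
    rw [sub_smul, mul_smul] at h2
    -- collect terms
    have : i • (cons (-1 : κˣ) ψ + cons u ψ) +
        i • (i • cons (-1 : κˣ) ψ + i • cons (-1 : κˣ) (cons (-1 : κˣ) d) - (cons (-1 : κˣ) (cons (-1 : κˣ) d) + cons (-1 : κˣ) (cons u d))) -
        (i • cons u ψ + i • -cons (-1 : κˣ) (cons u d) - 0) =
        (i • i • cons (-1 : κˣ) ψ + i • cons (-1 : κˣ) ψ) + (i • i • cons (-1 : κˣ) (cons (-1 : κˣ) d) - i • cons (-1 : κˣ) (cons (-1 : κˣ) d)) := by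
      simp only [zsmul_add, zsmul_sub, zsmul_neg, sub_zero]
      abel
    rw [this, h1, h2, add_zero]

/-- The four cases packaged: any one of them kills two consecutive steps. [cite: Milnor1970, §2 proof of Lemma 2.1 «There are four possibilities to consider» (p0007 L14–L37)] -/
theorem thetaStep_thetaStep_eq_zero_of_cases {i₀ i₁ : ℤ} {u₀ u₁ : κˣ}
    (H : (i₁ = 0 ∧ u₁ = 1) ∨ (i₀ = 0 ∧ u₀ = 1) ∨ (i₀ = 0 ∧ i₁ = 0 ∧ (u₀ : κ) + u₁ = 1) ∨ (i₁ = i₀ ∧ u₁ = -u₀))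
    (p : MilnorK κ (n + 1) × MilnorK κ n) : thetaStep (n + 1) i₀ u₀ (thetaStep n i₁ u₁ p) = 0 := by
  rcases H with ⟨rfl, rfl⟩ | ⟨rfl, rfl⟩ | ⟨rfl, rfl, h⟩ | ⟨rfl, rfl⟩
  · exact thetaStep_thetaStep_zero_one _ _ p
  · exact thetaStep_zero_one_thetaStep _ _ p
  · exact thetaStep_thetaStep_of_add_eq_one _ _ h p
  · exact thetaStep_thetaStep_neg _ _ p

/-- **The base pair `θ(l(πⁱu)) = l(u) + ξ·i`, i.e. `({u}, i·1) ∈ K₁F̄ × K₀F̄`** («l(πⁱu) ↦ iξ + l(ū)»).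
[cite: Milnor1970, §2 footnote ¹ (p0006 L41–L43); Lemma 2.1 «(For n = 1 the defining property is to be that ∂l(π) = 1.)» (p0005 L40)] -/
def thetaBase (i : ℤ) (u : κˣ) : MilnorK κ 1 × MilnorK κ 0 := (cons u one, i • one)

/-- The base pair is additive in `(i, u)`. [cite: Milnor1970, §2 proof of Lemma 2.1 (p0006 L27)] -/
theorem thetaBase_add_mul (i j : ℤ) (u w : κˣ) :
    thetaBase (i + j) (u * w) = thetaBase i u + thetaBase j w := by
  refine Prod.ext ?_ ?_
  · show cons (u * w) one = cons u one + cons w one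
    exact cons_mul u w one
  · show (i + j) • (one : MilnorK κ 0) = i • one + j • one
    exact add_zsmul _ _ _

/-- The four cases for a step applied to the base pair (symbols of length `2`). [cite: Milnor1970, §2 proof of Lemma 2.1 «we will carry out details only for the case π^{i₁}u₁ + π^{i₂}u₂ = 1» (p0007 L10–L37)] -/
theorem thetaStep_thetaBase_eq_zero_of_cases {i₀ i₁ : ℤ} {u₀ u₁ : κˣ}
    (H : (i₁ = 0 ∧ u₁ = 1) ∨ (i₀ = 0 ∧ u₀ = 1) ∨ (i₀ = 0 ∧ i₁ = 0 ∧ (u₀ : κ) + u₁ = 1) ∨ (i₁ = i₀ ∧ u₁ = -u₀)) :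
    thetaStep 0 i₀ u₀ (thetaBase i₁ u₁) = 0 := by
  rcases H with ⟨rfl, rfl⟩ | ⟨rfl, rfl⟩ | ⟨rfl, rfl, h⟩ | ⟨rfl, rfl⟩
  · have : thetaBase (κ := κ) 0 1 = 0 := Prod.ext (cons_one _) (zero_zsmul _)
    rw [this, map_zero]
  · rw [thetaStep_zero_one, AddMonoidHom.zero_apply]
  · refine Prod.ext ?_ ?_
    · show cons u₀ (cons u₁ one) = 0
      exact cons_cons_eq_zero_of_add_eq_one u₀ u₁ h _
    · show (0 : ℤ) • cons u₁ one + (0 : ℤ) • cons (-1) ((0 : ℤ) • one) - cons u₀ ((0 : ℤ) • (one : MilnorK κ 0)) = 0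
      rw [zero_zsmul, zero_zsmul, zero_zsmul, map_zero, sub_zero, add_zero]
  · refine Prod.ext ?_ ?_
    · show cons u₀ (cons (-u₀) one) = 0
      exact cons_cons_neg_self u₀ _
    · show i₁ • cons (-u₀) one + i₁ • cons (-1) (i₁ • one) - cons u₀ (i₁ • (one : MilnorK κ 0)) = 0
      rw [cons_neg, map_zsmul, map_zsmul, zsmul_add, ← mul_zsmul]
      have he : Even (i₁ + i₁ * i₁) := by rw [← one_add_mul, add_comm, mul_comm]; exact Int.even_mul_succ_self i₁
      have h0 := even_smul_cons_neg_one he (one : MilnorK κ 0)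
      rw [add_zsmul] at h0
      rw [← h0]; abel

end Step

end MilnorK

/-! ### §2 The valuation side: `x = π^{v(x)}u` and `ū` -/

section Residue

variable {F : Type*} [Field F] (v : Valuation F (WithZero (Multiplicative ℤ)))

/-- **The residue class field `F̄`** of the valuation (the residue field of the valuation ring `Λ`).
[cite: Milnor1970, §2 «a discrete valuation v with residue class field F̄» (p0005 L32–L33)] -/
abbrev ValResidueField : Type _ := IsLocalRing.ResidueField v.valuationSubring

variable {π : Fˣ}

/-- `v(x·π^{−v(x)}) = 0` for a prime `π`. [cite: Milnor1970, §2 «An element π of F• is prime if ord_v π = 1» (p0005 L34–L35)] -/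
theorem addVal_mul_zpow_neg_addVal (hπ : addVal v π = 1) (x : Fˣ) : addVal v (x * π ^ (-addVal v x)) = 0 := by
  rw [addVal_mul, addVal_zpow, hπ, mul_one, add_neg_cancel]

/-- **The unit part `u = x·π^{−v(x)} ∈ U` of `x = π^{v(x)}u`** («F• is generated by π and U»), a homomorphism.
[cite: Milnor1970, §2 proof of Lemma 2.1 «l(π^{i₁}u₁), …, l(π^{iₙ}uₙ)», «F• is generated by π and U» (p0006 L14, L21–L22)] -/
def unitPartOf (hπ : addVal v π = 1) : Fˣ →* v.valuationSubring.unitGroup where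
  toFun x := unitOfEqOne v (x * π ^ (-addVal v x)) (addVal_mul_zpow_neg_addVal v hπ x)
  map_one' := Subtype.ext (by simp)
  map_mul' x y := Subtype.ext (by
    simp only [coe_unitOfEqOne, Subgroup.coe_mul, addVal_mul, neg_add, zpow_add]
    simp only [mul_assoc, mul_left_comm])

/-- The value of `unitPartOf`. [cite: Milnor1970, §2 proof of Lemma 2.1 (p0006 L14, L21–L22)] -/
theorem coe_unitPartOf (hπ : addVal v π = 1) (x : Fˣ) : (unitPartOf v hπ x : Fˣ) = x * π ^ (-addVal v x) := rfl

/-- The unit part of a unit is itself. [cite: Milnor1970, §2 «The group of units (elements u with ord_v u = 0)» (p0005 L33–L34)] -/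
theorem unitPartOf_of_addVal_eq_zero (hπ : addVal v π = 1) {u : Fˣ} (hu : addVal v u = 0) :
    unitPartOf v hπ u = unitOfEqOne v u hu :=
  Subtype.ext (by rw [coe_unitPartOf, coe_unitOfEqOne, hu, neg_zero, zpow_zero, mul_one])

/-- The unit part of `π` is `1`. [cite: Milnor1970, §2 (p0005 L34–L35)] -/
theorem unitPartOf_pi (hπ : addVal v π = 1) : unitPartOf v hπ π = 1 :=
  Subtype.ext (by rw [coe_unitPartOf, hπ, zpow_neg, zpow_one, mul_inv_cancel]; rfl)

/-- **`x = πⁱu ↦ ū ∈ F̄•`** («the natural homomorphism U → F̄• by u ↦ ū», extended along `x = πⁱu`; this is the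
degree-one part `l(πⁱu) ↦ l(ū)` of `ψ`). [cite: Milnor1970, §2 (p0005 L33–L34), Lemma 2.2 «carries l(πⁱu) to l(ū)» (p0007 L46)] -/
def res (hπ : addVal v π = 1) : Fˣ →* (ValResidueField v)ˣ := (residueUnitHom v).comp (unitPartOf v hπ)

/-- The value of `res`. [cite: Milnor1970, §2 (p0005 L33–L34)] -/
theorem res_apply (hπ : addVal v π = 1) (x : Fˣ) : res v hπ x = residueUnitHom v (unitPartOf v hπ x) := rfl

/-- On units `res` is `u ↦ ū` (independent of `π`). [cite: Milnor1970, §2 «u ↦ ū» (p0005 L33–L34)] -/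
theorem res_of_addVal_eq_zero (hπ : addVal v π = 1) {u : Fˣ} (hu : addVal v u = 0) :
    res v hπ u = residueUnitHom v (unitOfEqOne v u hu) := by
  rw [res_apply, unitPartOf_of_addVal_eq_zero v hπ hu]

/-- `res π = 1` («l(π) ↦ ξ», no `K_*F̄`-part). [cite: Milnor1970, §2 footnote ¹ «l(πⁱu) ↦ iξ + l(ū)» (p0006 L41–L43)] -/
theorem res_pi (hπ : addVal v π = 1) : res v hπ π = 1 := by rw [res_apply, unitPartOf_pi, map_one]

/-- `res (−1) = −1`. [cite: Milnor1970, §2 proof of Lemma 2.1 «ū₂ = −ū₁» (p0007 L25)] -/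
theorem res_neg_one (hπ : addVal v π = 1) : res v hπ (-1) = -1 := by
  rw [res_of_addVal_eq_zero v hπ (addVal_neg_one v), residueUnitHom_neg_one]

/-- `res (−x) = −res x`. [cite: Milnor1970, §2 proof of Lemma 2.1 «ū₂ = −ū₁» (p0007 L25)] -/
theorem res_neg (hπ : addVal v π = 1) (x : Fˣ) : res v hπ (-x) = -res v hπ x := by
  rw [← neg_one_mul, map_mul, res_neg_one, neg_one_mul]

/-- `res (u πⁱ) = ū`. [cite: Milnor1970, §2 Lemma 2.2 «carries l(πⁱu) to l(ū)» (p0007 L46)] -/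
theorem res_unit_mul_pi_zpow (hπ : addVal v π = 1) {u : Fˣ} (hu : addVal v u = 0) (i : ℤ) :
    res v hπ (u * π ^ i) = residueUnitHom v (unitOfEqOne v u hu) := by
  rw [map_mul, map_zpow, res_pi, one_zpow, mul_one, res_of_addVal_eq_zero v hπ hu]

/-- Two units with `x + y = 1` have `x̄ + ȳ = 1` («If i₁ = i₂ = 0, then ū₁ + ū₂ = 1»). [cite: Milnor1970, §2 proof of Lemma 2.1 (p0007 L22)] -/
theorem coe_residueUnitHom_add_eq_one {x y : Fˣ} (hx : addVal v x = 0) (hy : addVal v y = 0) (h : (x : F) + y = 1) :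
    (residueUnitHom v (unitOfEqOne v x hx) : ValResidueField v) + residueUnitHom v (unitOfEqOne v y hy) = 1 := by
  rw [coe_residueUnitHom, coe_residueUnitHom, ← map_add, ← (IsLocalRing.residue v.valuationSubring).map_one]
  congr 1
  apply Subtype.ext
  rw [Subring.coe_add, Subring.coe_one]
  exact h

end Residue

/-! ### §3 The recursion `θ` and its descent to `K_{n+1}F` -/

namespace MilnorK

open Function

variable {F : Type*} [Field F] (v : Valuation F (WithZero (Multiplicative ℤ))) {π : Fˣ} (hπ : addVal v π = 1)

section Theta

variable {n : ℕ}

/-- The step as an additive function of `l(a) ∈ K₁F`, `a = πⁱu ↦ G(i, ū)`. [cite: Milnor1970, §2 proof of Lemma 2.1 (p0006 L21–L27)] -/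
def thetaStepOf (n : ℕ) :
    Additive Fˣ →+ (MilnorK (ValResidueField v) (n + 1) × MilnorK (ValResidueField v) n →+
      MilnorK (ValResidueField v) (n + 2) × MilnorK (ValResidueField v) (n + 1)) :=
  AddMonoidHom.mk' (fun m => thetaStep n (addVal v (Additive.toMul m)) (res v hπ (Additive.toMul m))) fun m m' => by
    rw [toMul_add, addVal_mul, map_mul, thetaStep_add_mul]

/-- The value of `thetaStepOf` at `l(a)`. [cite: Milnor1970, §2 proof of Lemma 2.1 (p0006 L21–L27)] -/
theorem thetaStepOf_ofMul (n : ℕ) (a : Fˣ) :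
    thetaStepOf v hπ n (Additive.ofMul a) = thetaStep n (addVal v a) (res v hπ a) := rfl

/-- The base pair as an additive function of `l(a)`, `a = πⁱu ↦ ({ū}, i)`. [cite: Milnor1970, §2 footnote ¹ (p0006 L41–L43)] -/
def thetaBaseOf : Additive Fˣ →+ MilnorK (ValResidueField v) 1 × MilnorK (ValResidueField v) 0 :=
  AddMonoidHom.mk' (fun m => thetaBase (addVal v (Additive.toMul m)) (res v hπ (Additive.toMul m))) fun m m' => by
    rw [toMul_add, addVal_mul, map_mul, thetaBase_add_mul]

/-- The value of `thetaBaseOf` at `l(a)`. [cite: Milnor1970, §2 footnote ¹ (p0006 L41–L43)] -/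
theorem thetaBaseOf_ofMul (a : Fˣ) : thetaBaseOf v hπ (Additive.ofMul a) = thetaBase (addVal v a) (res v hπ a) := rfl

/-- Currying the first variable: `l(a) ↦ G(a) ∘ Θ`. [cite: Milnor1970, §2 proof of Lemma 2.1 (p0006 L21–L27)] -/
def thetaSuccCurried (n : ℕ)
    (Θ : MultilinearMap ℤ (fun _ : Fin (n + 1) => Additive Fˣ)
      (MilnorK (ValResidueField v) (n + 1) × MilnorK (ValResidueField v) n)) :
    Additive Fˣ →+ MultilinearMap ℤ (fun _ : Fin (n + 1) => Additive Fˣ)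
      (MilnorK (ValResidueField v) (n + 2) × MilnorK (ValResidueField v) (n + 1)) :=
  AddMonoidHom.mk' (fun m => ((thetaStepOf v hπ n m).toIntLinearMap).compMultilinearMap Θ) fun m m' => by
    ext x <;> simp

/-- **Milnor's `n`-linear expansion `θ = (ψ-part, ∂-part) : (K₁F)^{n+1} → K_{n+1}F̄ × K_nF̄`**, by recursion on the
length: `Θ₀(l(a)) = ({ū}, i)`, `Θ_{n+1}(l(a), m) = G(a)(Θₙ(m))` («construct a sequence of elements φⱼ … Evidently each
φⱼ is n-linear»). [cite: Milnor1970, §2 proof of Lemma 2.1 (p0006 L19–L33)] -/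
def theta : (n : ℕ) → MultilinearMap ℤ (fun _ : Fin (n + 1) => Additive Fˣ)
    (MilnorK (ValResidueField v) (n + 1) × MilnorK (ValResidueField v) n)
  | 0 => MultilinearMap.ofSubsingleton ℤ (Additive Fˣ) _ (0 : Fin 1) (thetaBaseOf v hπ).toIntLinearMap
  | n + 1 => LinearMap.uncurryLeft (thetaSuccCurried v hπ n (theta n)).toIntLinearMap

/-- `Θ₀(m) = θ-base of m₀`. [cite: Milnor1970, §2 proof of Lemma 2.1 (p0006 L19–L27)] -/
theorem theta_zero_apply (m : Fin 1 → Additive Fˣ) : theta v hπ 0 m = thetaBaseOf v hπ (m 0) := rfl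

/-- `Θ_{n+1}(m) = G(m₀)(Θₙ(tail m))`. [cite: Milnor1970, §2 proof of Lemma 2.1 (p0006 L19–L27)] -/
theorem theta_succ_apply (n : ℕ) (m : Fin (n + 2) → Additive Fˣ) :
    theta v hπ (n + 1) m = thetaStepOf v hπ n (m 0) (theta v hπ n (Fin.tail m)) := rfl

/-- `tail (l ∘ a) = l ∘ tail a`. [cite: Milnor1970, §2 proof of Lemma 2.1 (p0006 L21–L22)] -/
theorem tail_ofMul_comp (a : Fin (n + 1) → Fˣ) :
    Fin.tail (fun j => Additive.ofMul (a j)) = fun j => Additive.ofMul (Fin.tail a j) := rfl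

/-- **«There are four possibilities to consider»**: `x + y = 1` in `F` forces (i) `v(y) = 0`, `ȳ = 1` (when `v(x) > 0`),
or (ii) `v(x) = 0`, `x̄ = 1` (when `v(y) > 0`), or (iii) both units with `x̄ + ȳ = 1`, or (iv) `v(y) = v(x)`, `ȳ = −x̄`
(when `v(x) < 0`). [cite: Milnor1970, §2 proof of Lemma 2.1 (p0007 L14–L25); Milnor1972, §11 proof of Lemma 11.5] -/
theorem rel_cases {x y : Fˣ} (h : (x : F) + y = 1) :
    (addVal v y = 0 ∧ res v hπ y = 1) ∨ (addVal v x = 0 ∧ res v hπ x = 1) ∨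
      (addVal v x = 0 ∧ addVal v y = 0 ∧ (res v hπ x : ValResidueField v) + res v hπ y = 1) ∨
      (addVal v y = addVal v x ∧ res v hπ y = -res v hπ x) := by
  rcases lt_trichotomy 0 (addVal v x) with hx | hx | hx
  · obtain ⟨hy, hres⟩ := addVal_eq_zero_and_residue_eq_one_of_pos v h hx
    exact Or.inl ⟨hy, by rw [res_of_addVal_eq_zero v hπ hy, hres]⟩
  · rcases lt_trichotomy 0 (addVal v y) with hy | hy | hy
    · obtain ⟨hx', hres⟩ := addVal_eq_zero_and_residue_eq_one_of_pos v ((add_comm _ _).trans h) hy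
      exact Or.inr (Or.inl ⟨hx', by rw [res_of_addVal_eq_zero v hπ hx', hres]⟩)
    · refine Or.inr (Or.inr (Or.inl ⟨hx.symm, hy.symm, ?_⟩))
      rw [res_of_addVal_eq_zero v hπ hx.symm, res_of_addVal_eq_zero v hπ hy.symm]
      exact coe_residueUnitHom_add_eq_one v hx.symm hy.symm h
    · obtain ⟨hxy, w, hw, hyw, hres⟩ := addVal_eq_and_eq_neg_mul_of_neg v ((add_comm _ _).trans h) hy
      exact absurd hxy (by omega)
  · obtain ⟨hxy, w, hw, hyw, hres⟩ := addVal_eq_and_eq_neg_mul_of_neg v h hx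
    refine Or.inr (Or.inr (Or.inr ⟨hxy, ?_⟩))
    rw [hyw, map_mul, res_neg, res_of_addVal_eq_zero v hπ hw, hres, _root_.mul_one]

/-- **`θ` kills the Steinberg relations: «If two successive π^{iⱼ}uⱼ add up to 1, we will prove that φ = 0»** (behind
the two slots everything is linear, so it suffices to treat the two front slots — by the four cases).
[cite: Milnor1970, §2 proof of Lemma 2.1 (p0006 L34 – p0007 L37)] -/
theorem theta_eq_zero_of_add_eq_one (n : ℕ) (a : Fin (n + 1) → Fˣ) (j : Fin (n + 1)) (hj : j.val + 1 < n + 1)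
    (hsum : (a j : F) + a (finSucc j hj) = 1) : theta v hπ n (fun k => Additive.ofMul (a k)) = 0 := by
  induction n with
  | zero => omega
  | succ n ih =>
    rw [theta_succ_apply, tail_ofMul_comp]
    cases j using Fin.cases with
    | zero =>
      -- the relation sits in the two front slots
      have h1 : finSucc (0 : Fin (n + 2)) hj = (0 : Fin (n + 1)).succ := rfl
      rw [h1] at hsum
      change (a 0 : F) + Fin.tail a 0 = 1 at hsum
      cases n with
      | zero =>
        rw [theta_zero_apply, thetaStepOf_ofMul]
        exact thetaStep_thetaBase_eq_zero_of_cases (rel_cases v hπ hsum)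
      | succ n =>
        rw [theta_succ_apply, thetaStepOf_ofMul, tail_ofMul_comp, thetaStepOf_ofMul]
        exact thetaStep_thetaStep_eq_zero_of_cases (rel_cases v hπ hsum) _
    | succ j =>
      have hj' : j.val + 1 < n + 1 := by rw [Fin.val_succ] at hj; omega
      have h1 : finSucc j.succ hj = (finSucc j hj').succ := Fin.ext (by simp [finSucc])
      rw [h1] at hsum
      rw [ih (Fin.tail a) j hj' hsum, map_zero]

/-- **`θ_π = (ψ, ∂) : K_{n+1}F →+ K_{n+1}F̄ × K_nF̄`**, the descent of `theta` («this will show that the correspondence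
… is well defined and extends to a homomorphism K_nF → K_{n−1}F̄»). [cite: Milnor1970, §2 proof of Lemma 2.1 (p0006 L34 – p0007 L7), footnote ¹ «θ_π(α) = ψ(α) + ξ∂(α)» (p0006 L44–L46)] -/
def thetaHom (n : ℕ) : MilnorK F (n + 1) →+ MilnorK (ValResidueField v) (n + 1) × MilnorK (ValResidueField v) n :=
  lift (theta v hπ n) (theta_eq_zero_of_add_eq_one v hπ n)

/-- `θ{a} = Θ(l ∘ a)`. [cite: Milnor1970, §2 proof of Lemma 2.1 (p0006 L34 – p0007 L7)] -/
theorem thetaHom_symbol (n : ℕ) (a : Fin (n + 1) → Fˣ) :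
    thetaHom v hπ n (symbol a) = theta v hπ n (fun k => Additive.ofMul (a k)) := lift_symbol _ _ a

/-- `θ{a} = ({ā}, v(a))` in length one. [cite: Milnor1970, §2 footnote ¹ «l(πⁱu) ↦ iξ + l(ū)» (p0006 L41–L43)] -/
theorem thetaHom_zero_symbol (a : Fin 1 → Fˣ) :
    thetaHom v hπ 0 (symbol a) = thetaBase (addVal v (a 0)) (res v hπ (a 0)) := by
  rw [thetaHom_symbol, theta_zero_apply, thetaBaseOf_ofMul]

/-- `θ{x, b} = G(x)(θ{b})`. [cite: Milnor1970, §2 proof of Lemma 2.1 (p0006 L19–L27)] -/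
theorem thetaHom_succ_symbol_cons (n : ℕ) (x : Fˣ) (b : Fin (n + 1) → Fˣ) :
    thetaHom v hπ (n + 1) (symbol (Fin.cons x b : Fin (n + 2) → Fˣ)) =
      thetaStep n (addVal v x) (res v hπ x) (thetaHom v hπ n (symbol b)) := by
  rw [thetaHom_symbol, theta_succ_apply, thetaHom_symbol]
  rfl

/-- **`θ(l(x)·z) = G(x)(θ(z))`** — `θ` is multiplicative against `K₁F` («extends uniquely to a ring homomorphism θ_π»).
[cite: Milnor1970, §2 footnote ¹ (p0006 L41–L46)] -/
theorem thetaHom_succ_cons (n : ℕ) (x : Fˣ) (z : MilnorK F (n + 1)) :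
    thetaHom v hπ (n + 1) (cons x z) = thetaStep n (addVal v x) (res v hπ x) (thetaHom v hπ n z) := by
  have h : (thetaHom v hπ (n + 1)).comp (cons x) = (thetaStep n (addVal v x) (res v hπ x)).comp (thetaHom v hπ n) :=
    hom_ext fun b => by rw [AddMonoidHom.comp_apply, AddMonoidHom.comp_apply, cons_symbol, thetaHom_succ_symbol_cons]
  exact DFunLike.congr_fun h z

end Theta

/-! ### §4 `ψ` and `∂`, their recursions and defining properties -/

section PsiPartial

variable {n : ℕ}

/-- Every element of `K₀R = ℤ` is an integer multiple of `1`. [cite: Milnor1970, §1 «(ℤ, K₁F, K₁F ⊗ K₁F, …)» (p0002 L5–L8)] -/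
theorem eq_zsmul_one {R : Type*} [CommRing R] (z : MilnorK R 0) : z = zeroEquiv R z • (one : MilnorK R 0) := by
  apply (zeroEquiv R).injective
  rw [map_zsmul, one, zeroEquiv_symbol, smul_eq_mul, _root_.mul_one]

/-- `zeroEquiv 1 = 1`. [cite: Milnor1970, §1 (p0002 L5–L8)] -/
theorem zeroEquiv_one {R : Type*} [CommRing R] : zeroEquiv R (one : MilnorK R 0) = 1 := zeroEquiv_symbol R _

/-- **`ψ` in degree `0`**: the identity `ℤ = K₀F → K₀F̄ = ℤ` (a ring homomorphism is unital). [cite: Milnor1970, §2 Lemma 2.2 «ring homomorphism ψ : K_*F → K_*F̄» (p0007 L39–L46)] -/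
def psiZero : MilnorK F 0 →+ MilnorK (ValResidueField v) 0 :=
  ((zeroEquiv (ValResidueField v)).symm.toAddMonoidHom).comp (zeroEquiv F).toAddMonoidHom

/-- `ψ(1) = 1`. [cite: Milnor1970, §2 Lemma 2.2 (p0007 L39–L46)] -/
theorem psiZero_one : psiZero v (one : MilnorK F 0) = one := by
  rw [psiZero, AddMonoidHom.comp_apply, AddEquiv.coe_toAddMonoidHom, AddEquiv.coe_toAddMonoidHom, zeroEquiv_one,
    ← zeroEquiv_one (R := ValResidueField v), AddEquiv.symm_apply_apply]

/-- `ψ{} = {}` (the empty symbol). [cite: Milnor1970, §2 Lemma 2.2 (p0007 L39–L49)] -/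
theorem psiZero_symbol (a : Fin 0 → Fˣ) : psiZero v (symbol a) = symbol (fun j => res v hπ (a j)) := by
  have ha : symbol a = one := congrArg symbol (funext fun j => Fin.elim0 j)
  have hb : symbol (fun j => res v hπ (a j)) = one := congrArg symbol (funext fun j => Fin.elim0 j)
  rw [ha, hb]
  exact psiZero_one v

/-- **`ψ = ψ_π : K_nF →+ K_nF̄`** (Lemma 2.2), degree-wise: the `K_*F̄`-part of `θ_π`. [cite: Milnor1970, §2 Lemma 2.2 (p0007 L39–L49), footnote ¹ «θ_π(α) = ψ(α) + ξ∂(α)» (p0006 L44–L46)] -/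
def psi : (n : ℕ) → MilnorK F n →+ MilnorK (ValResidueField v) n
  | 0 => psiZero v
  | n + 1 => (AddMonoidHom.fst _ _).comp (thetaHom v hπ n)

/-- **`∂ = ∂_v : K_{n+1}F →+ K_nF̄`** (Lemma 2.1): the `ξ`-part of `θ_π`. [cite: Milnor1970, §2 Lemma 2.1 (p0005 L36–L40), footnote ¹ «θ_π(α) = ψ(α) + ξ∂(α)» (p0006 L44–L46)] -/
def boundary (n : ℕ) : MilnorK F (n + 1) →+ MilnorK (ValResidueField v) n :=
  (AddMonoidHom.snd _ _).comp (thetaHom v hπ n)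

/-- `θ = (ψ, ∂)`. [cite: Milnor1970, §2 footnote ¹ «θ_π(α) = ψ(α) + ξ∂(α)» (p0006 L44–L46)] -/
theorem thetaHom_eq (n : ℕ) (z : MilnorK F (n + 1)) :
    thetaHom v hπ n z = (psi v hπ (n + 1) z, boundary v hπ n z) := rfl

/-- `ψ` is the first component of `θ`. [cite: Milnor1970, §2 footnote ¹ (p0006 L44–L46)] -/
theorem psi_succ_apply (n : ℕ) (z : MilnorK F (n + 1)) : psi v hπ (n + 1) z = (thetaHom v hπ n z).1 := rfl

/-- `∂` is the second component of `θ`. [cite: Milnor1970, §2 footnote ¹ (p0006 L44–L46)] -/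
theorem boundary_apply (n : ℕ) (z : MilnorK F (n + 1)) : boundary v hπ n z = (thetaHom v hπ n z).2 := rfl

/-- `ψ{a} = {ā}` in degree `1` («carries l(πⁱu) to l(ū)»). [cite: Milnor1970, §2 Lemma 2.2 (p0007 L46)] -/
theorem psi_one_symbol (a : Fin 1 → Fˣ) : psi v hπ 1 (symbol a) = symbol (fun j => res v hπ (a j)) := by
  rw [psi_succ_apply, thetaHom_zero_symbol]
  show cons (res v hπ (a 0)) one = _
  rw [one, cons_symbol]
  congr 1
  funext j
  rw [Fin.eq_zero j]
  rfl

/-- `∂{a} = v(a)·1` in degree `0` («For n = 1 … ord_v»). [cite: Milnor1970, §2 Remarks (p0005 L42–L44)] -/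
theorem boundary_zero_symbol (a : Fin 1 → Fˣ) : boundary v hπ 0 (symbol a) = addVal v (a 0) • one := by
  rw [boundary_apply, thetaHom_zero_symbol]; rfl

/-- **The recursion for `ψ`: `ψ(l(x)·z) = l(x̄)·ψ(z)`.** [cite: Milnor1970, §2 footnote ¹ «l(πⁱu) ↦ iξ + l(ū) extends … to a ring homomorphism» (p0006 L41–L46)] -/
theorem psi_cons (n : ℕ) (x : Fˣ) (z : MilnorK F (n + 1)) :
    psi v hπ (n + 2) (cons x z) = cons (res v hπ x) (psi v hπ (n + 1) z) := by
  rw [psi_succ_apply, thetaHom_succ_cons, thetaStep_fst, psi_succ_apply]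

/-- **The recursion for `∂`: `∂(l(x)·z) = v(x)·ψ(z) + v(x)·l(−1)·∂(z) − l(x̄)·∂(z)`** (the `ξ`-coefficient of
`(v(x)ξ + l(x̄))(ψ(z) + ξ∂(z))`, using `ξl(x̄) = −l(x̄)ξ` and `ξ² = ξl(−1)`). [cite: Milnor1970, §2 footnote ¹ (p0006 L38–L46)] -/
theorem boundary_cons (n : ℕ) (x : Fˣ) (z : MilnorK F (n + 1)) :
    boundary v hπ (n + 1) (cons x z) =
      addVal v x • psi v hπ (n + 1) z + addVal v x • cons (-1) (boundary v hπ n z) - cons (res v hπ x) (boundary v hπ n z) := by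
  rw [boundary_apply, thetaHom_succ_cons, thetaStep_snd, psi_succ_apply, boundary_apply]

/-- The recursion for `ψ` from degree `0`. [cite: Milnor1970, §2 Lemma 2.2 (p0007 L39–L49)] -/
theorem psi_one_cons (x : Fˣ) (z : MilnorK F 0) : psi v hπ 1 (cons x z) = cons (res v hπ x) (psi v hπ 0 z) := by
  have h1 : psi v hπ 1 (cons x one) = cons (res v hπ x) one := by
    rw [one, cons_symbol, psi_one_symbol, one, cons_symbol]
    congr 1; funext j; exact Fin.cases rfl (fun k => k.elim0) j
  rw [eq_zsmul_one z, map_zsmul, map_zsmul, map_zsmul, map_zsmul, h1]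
  show _ = _ • cons (res v hπ x) (psiZero v one)
  rw [psiZero_one]

/-- **LEMMA 2.2, the rule `ψ{π^{i₁}u₁, …, π^{iₙ}uₙ} = {ū₁, …, ūₙ}`.** [cite: Milnor1970, §2 Lemma 2.2 «ψ is defined by the rule l(π^{i₁}u₁)⋯l(π^{iₙ}uₙ) ↦ l(ū₁)⋯l(ūₙ)» (p0007 L47–L49)] -/
theorem psi_symbol (n : ℕ) (a : Fin n → Fˣ) : psi v hπ n (symbol a) = symbol (fun j => res v hπ (a j)) := by
  induction n with
  | zero => exact psiZero_symbol v hπ a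
  | succ n ih =>
    cases n with
    | zero => exact psi_one_symbol v hπ a
    | succ n =>
      rw [← Fin.cons_self_tail a, ← cons_symbol, psi_cons, ih, cons_symbol]
      congr 1
      funext j
      refine Fin.cases rfl (fun k => rfl) j

/-- **«This homomorphism ∂ annihilates every product of the form l(u₁)⋯l(uₙ).»** [cite: Milnor1970, §2 Lemma 2.1 (p0005 L38–L39), proof (p0006 L8–L12)] -/
theorem boundary_symbol_eq_zero_of_units (n : ℕ) (u : Fin (n + 1) → Fˣ) (hu : ∀ j, addVal v (u j) = 0) :
    boundary v hπ n (symbol u) = 0 := by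
  induction n with
  | zero => rw [boundary_zero_symbol, hu 0, zero_zsmul]
  | succ n ih =>
    rw [← Fin.cons_self_tail u, ← cons_symbol, boundary_cons, hu 0, zero_zsmul, zero_zsmul, zero_add, zero_sub,
      ih (Fin.tail u) (fun j => hu j.succ), map_zero, neg_zero]

/-- **LEMMA 2.1, the defining property: `∂{π′, u₂, …, u_{n+1}} = {ū₂, …, ū_{n+1}}` for EVERY prime element `π′` and
all units `uⱼ`** («Since it is clear that l(πu)l(u₂)⋯l(uₙ) maps to l(ū₂)⋯l(ūₙ), this will complete the proof»).
[cite: Milnor1970, §2 Lemma 2.1 (p0005 L36–L39), proof (p0007 L8–L9)] -/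
theorem boundary_symbol_cons_units (n : ℕ) {ϖ : Fˣ} (hϖ : addVal v ϖ = 1) (u : Fin n → Fˣ) (hu : ∀ j, addVal v (u j) = 0) :
    boundary v hπ n (symbol (Fin.cons ϖ u : Fin (n + 1) → Fˣ)) =
      symbol (fun j => residueUnitHom v (unitOfEqOne v (u j) (hu j))) := by
  cases n with
  | zero =>
    rw [boundary_zero_symbol, Fin.cons_zero, hϖ, one_zsmul, one]
    congr 1; funext j; exact Fin.elim0 j
  | succ n =>
    rw [← cons_symbol, boundary_cons, hϖ, one_zsmul, one_zsmul, boundary_symbol_eq_zero_of_units v hπ n u hu, map_zero,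
      map_zero, add_zero, sub_zero, psi_symbol]
    congr 1; funext j; exact res_of_addVal_eq_zero v hπ (hu j)

end PsiPartial

/-! ### §5 Uniqueness: the symbols `{π′, u₂, …, u_{n+1}}` generate `K_{n+1}F` -/

section Generation

variable {n : ℕ}

/-- Lemma 1.2 at the slots `0` and `s`: an entry equal to the front entry may be replaced by `−1` («using the
identity l(π)^r = l(π)l(−1)^{r−1}»). [cite: Milnor1970, §2 proof of uniqueness (p0006 L16–L17); §1 Lemma 1.2 (p0002 L48–L50)] -/
theorem symbol_eq_symbol_update_neg_one (a : Fin (n + 1) → Fˣ) {s : Fin (n + 1)} (hs : s ≠ 0) (heq : a s = a 0) :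
    symbol a = symbol (update a s (-1)) := by
  cases n with
  | zero => exact absurd (Fin.eq_zero s) hs
  | succ n =>
    have h01 : (0 : Fin (n + 2)).val + 1 < n + 2 := by simp
    have hfs : finSucc (0 : Fin (n + 2)) h01 = 1 := Fin.ext (by simp [finSucc])
    by_cases hs1 : s = 1
    · subst hs1
      have := symbol_eq_of_eq_self a 0 h01 (by rw [hfs]; exact heq)
      rwa [hfs] at this
    · set c := a ∘ Equiv.swap 1 s with hc
      have hc1 : c 1 = c 0 := by
        simp only [hc, Function.comp_apply, Equiv.swap_apply_left,
          Equiv.swap_apply_of_ne_of_ne Fin.zero_ne_one hs.symm]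
        exact heq
      have h1 : symbol c = -symbol a := symbol_comp_swap_of_ne a (Ne.symm hs1)
      have h2 : symbol c = symbol (update c 1 (-1)) := by
        have := symbol_eq_of_eq_self c 0 h01 (by rw [hfs]; exact hc1)
        rwa [hfs] at this
      have h3 : update c 1 (-1) = update a s (-1) ∘ Equiv.swap 1 s := by
        funext j
        simp only [hc, Function.comp_apply]
        by_cases hj1 : j = 1
        · subst hj1; rw [update_self, Equiv.swap_apply_left, update_self]
        · rw [update_of_ne hj1, Function.comp_apply]
          by_cases hjs : j = s
          · subst hjs; rw [Equiv.swap_apply_right, update_of_ne (Ne.symm hj1)]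
          · rw [Equiv.swap_apply_of_ne_of_ne hj1 hjs, update_of_ne hjs]
      have h4 : symbol (update c 1 (-1)) = -symbol (update a s (-1)) := by
        rw [h3]; exact symbol_comp_swap_of_ne _ (Ne.symm hs1)
      rw [h2, h4, neg_inj] at h1
      exact h1.symm

variable (n) in
/-- **The set of the symbols `{π′, u₂, …, u_{n+1}}`** with `π′` prime and `uⱼ` units («products of the form
l(π)l(u₂)⋯l(uₙ) … for every prime element π and for all units»). [cite: Milnor1970, §2 Lemma 2.1 (p0005 L36–L38)] -/
def primeUnitSymbols : Set (MilnorK F (n + 1)) :=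
  {z | ∃ (ϖ : Fˣ) (u : Fin n → Fˣ), addVal v ϖ = 1 ∧ (∀ j, addVal v (u j) = 0) ∧ z = symbol (Fin.cons ϖ u : Fin (n + 1) → Fˣ)}

/-- The generators lie in the closure. [cite: Milnor1970, §2 proof of uniqueness (p0006 L14–L18)] -/
theorem symbol_cons_mem_closure_of_units {ϖ : Fˣ} (hϖ : addVal v ϖ = 1) (u : Fin n → Fˣ) (hu : ∀ j, addVal v (u j) = 0) :
    symbol (Fin.cons ϖ u : Fin (n + 1) → Fˣ) ∈ AddSubgroup.closure (primeUnitSymbols v n) :=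
  AddSubgroup.subset_closure ⟨ϖ, u, hϖ, hu, rfl⟩

/-- `y = (yπ′^{−v(y)})·π′^{v(y)}` («F• is generated by π and U»). [cite: Milnor1970, §2 proof of uniqueness (p0006 L14)] -/
theorem eq_unitPartOf_mul_zpow {ϖ : Fˣ} (hϖ : addVal v ϖ = 1) (y : Fˣ) :
    y = (unitPartOf v hϖ y : Fˣ) * ϖ ^ addVal v y := by
  rw [coe_unitPartOf, _root_.mul_assoc, ← zpow_add, neg_add_cancel, zpow_zero, _root_.mul_one]

/-- Elements of `U` have valuation `0`. [cite: Milnor1970, §2 «elements u with ord_v u = 0» (p0005 L33–L34)] -/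
theorem addVal_coe_unitGroup (w : v.valuationSubring.unitGroup) : addVal v (w : Fˣ) = 0 :=
  (mem_unitGroup_iff_addVal_eq_zero v _).1 w.2

/-- Induction over the slots behind a fixed prime `π′`: a tail whose entries from index `k` on are units gives an element
of the closure («K_nF is generated by products of the form l(π)^r l(u_{r+1})⋯l(uₙ) … if r > 1 then using the identity
l(π)^r = l(π)l(−1)^{r−1} it is also specified»). [cite: Milnor1970, §2 proof of uniqueness (p0006 L14–L18)] -/
theorem symbol_cons_mem_closure_aux {ϖ : Fˣ} (hϖ : addVal v ϖ = 1) (k : ℕ) :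
    ∀ b : Fin n → Fˣ, (∀ j : Fin n, k ≤ j.val → addVal v (b j) = 0) →
      symbol (Fin.cons ϖ b : Fin (n + 1) → Fˣ) ∈ AddSubgroup.closure (primeUnitSymbols v n) := by
  induction k with
  | zero => exact fun b hb => symbol_cons_mem_closure_of_units v hϖ b fun j => hb j (Nat.zero_le _)
  | succ k ih =>
    intro b hb
    by_cases hk : k < n
    · set jk : Fin n := ⟨k, hk⟩ with hjk
      -- every unit `y` in slot `k` (with units after it)
      have hunit : ∀ y : Fˣ, addVal v y = 0 →
          symbol (Fin.cons ϖ (update b jk y) : Fin (n + 1) → Fˣ) ∈ AddSubgroup.closure (primeUnitSymbols v n) := by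
        intro y hy
        refine ih _ fun j hj => ?_
        by_cases hjj : j = jk
        · subst hjj; rw [update_self]; exact hy
        · rw [update_of_ne hjj]
          refine hb j (lt_of_le_of_ne hj ?_)
          intro h; exact hjj (Fin.ext (by rw [hjk]; exact h.symm))
      -- `π′` in slot `k`: `{π′, …, π′, …} = {π′, …, −1, …}`
      have hprime : symbol (Fin.cons ϖ (update b jk ϖ) : Fin (n + 1) → Fˣ) ∈ AddSubgroup.closure (primeUnitSymbols v n) := by
        rw [symbol_eq_symbol_update_neg_one (Fin.cons ϖ (update b jk ϖ)) (Fin.succ_ne_zero jk)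
          (by rw [Fin.cons_succ, Fin.cons_zero, update_self]), ← Fin.cons_update, update_idem]
        exact hunit (-1) (addVal_neg_one v)
      -- decompose `b jk = w π′^i`
      have hdec : symbol (Fin.cons ϖ b : Fin (n + 1) → Fˣ) =
          symbol (Fin.cons ϖ (update b jk (unitPartOf v hϖ (b jk) : Fˣ)) : Fin (n + 1) → Fˣ) +
            addVal v (b jk) • symbol (Fin.cons ϖ (update b jk ϖ) : Fin (n + 1) → Fˣ) := by
        conv_lhs => rw [← update_eq_self jk b, eq_unitPartOf_mul_zpow v hϖ (b jk)]
        rw [Fin.cons_update, Fin.cons_update, Fin.cons_update, symbol_update_mul, symbol_update_zpow]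
      rw [hdec]
      exact AddSubgroup.add_mem _ (hunit _ (addVal_coe_unitGroup v _)) (AddSubgroup.zsmul_mem _ hprime _)
    · exact ih b fun j hj => absurd (lt_of_lt_of_le j.isLt (le_trans (not_lt.1 hk) hj)) (lt_irrefl _)

/-- Every `{π′, b}` with `π′` prime lies in the closure. [cite: Milnor1970, §2 proof of uniqueness (p0006 L14–L18)] -/
theorem symbol_cons_prime_mem_closure {ϖ : Fˣ} (hϖ : addVal v ϖ = 1) (b : Fin n → Fˣ) :
    symbol (Fin.cons ϖ b : Fin (n + 1) → Fˣ) ∈ AddSubgroup.closure (primeUnitSymbols v n) :=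
  symbol_cons_mem_closure_aux v hϖ n b fun j hj => absurd (lt_of_lt_of_le j.isLt hj) (lt_irrefl _)

include hπ in
/-- Every symbol lies in the closure: `{a₀, b} = {wπ, b} − {π, b} + v(a₀)·{π, b}` with `a₀ = wπ^{v(a₀)}` («any unit u₁
can be expressed as the quotient πu₁/π of two prime elements»). [cite: Milnor1970, §2 proof of Lemma 2.1 (p0006 L8–L18)] -/
theorem symbol_mem_closure_primeUnitSymbols (a : Fin (n + 1) → Fˣ) :
    symbol a ∈ AddSubgroup.closure (primeUnitSymbols v n) := by
  have hwπ : addVal v ((unitPartOf v hπ (a 0) : Fˣ) * π) = 1 := by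
    rw [addVal_mul, addVal_coe_unitGroup, hπ, zero_add]
  have hdec : symbol a = cons ((unitPartOf v hπ (a 0) : Fˣ) * π) (symbol (Fin.tail a)) - cons π (symbol (Fin.tail a)) +
      addVal v (a 0) • cons π (symbol (Fin.tail a)) := by
    conv_lhs => rw [← Fin.cons_self_tail a, ← cons_symbol, eq_unitPartOf_mul_zpow v hπ (a 0)]
    rw [cons_mul, cons_zpow, cons_mul, add_sub_cancel_right]
  rw [hdec, cons_symbol, cons_symbol]
  exact AddSubgroup.add_mem _ (AddSubgroup.sub_mem _ (symbol_cons_prime_mem_closure v hwπ _)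
    (symbol_cons_prime_mem_closure v hπ _)) (AddSubgroup.zsmul_mem _ (symbol_cons_prime_mem_closure v hπ _) _)

include hπ in
/-- **The symbols `{π′, u₂, …, u_{n+1}}` generate `K_{n+1}F`** («it follows that K_nF is generated by products of the
form l(π)^r l(u_{r+1})⋯l(uₙ)»). [cite: Milnor1970, §2 proof of uniqueness (p0006 L14–L18)] -/
theorem closure_primeUnitSymbols : AddSubgroup.closure (primeUnitSymbols v n) = ⊤ := by
  rw [eq_top_iff]
  rintro z -
  induction z using induction_on with
  | hsym k a => exact AddSubgroup.zsmul_mem _ (symbol_mem_closure_primeUnitSymbols v hπ a) k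
  | hadd x y hx hy => exact AddSubgroup.add_mem _ hx hy

include hπ in
/-- **Uniqueness principle**: two homomorphisms out of `K_{n+1}F` agreeing on the `{π′, u₂, …, u_{n+1}}` are equal.
[cite: Milnor1970, §2 proof of uniqueness «This proves that ∂ is unique, if it exists» (p0006 L14–L18)] -/
theorem hom_ext_primeUnitSymbols {A : Type*} [AddCommGroup A] {f g : MilnorK F (n + 1) →+ A}
    (h : ∀ (ϖ : Fˣ), addVal v ϖ = 1 → ∀ (u : Fin n → Fˣ), (∀ j, addVal v (u j) = 0) →
      f (symbol (Fin.cons ϖ u : Fin (n + 1) → Fˣ)) = g (symbol (Fin.cons ϖ u : Fin (n + 1) → Fˣ))) : f = g := by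
  refine AddMonoidHom.eq_of_eqOn_dense (closure_primeUnitSymbols v hπ) ?_
  rintro z ⟨ϖ, u, hϖ, hu, rfl⟩
  exact h ϖ hϖ u hu

/-- **LEMMA 2.1, uniqueness**: a homomorphism `D : K_{n+1}F → K_nF̄` with `D{π′, u₂, …} = {ū₂, …}` for every prime `π′`
and all units is `∂`. [cite: Milnor1970, §2 Lemma 2.1 «one and only one homomorphism» (p0005 L36–L39), proof of uniqueness (p0006 L14–L18)] -/
theorem boundary_unique (D : MilnorK F (n + 1) →+ MilnorK (ValResidueField v) n)
    (hD : ∀ (ϖ : Fˣ), addVal v ϖ = 1 → ∀ (u : Fin n → Fˣ) (hu : ∀ j, addVal v (u j) = 0),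
      D (symbol (Fin.cons ϖ u : Fin (n + 1) → Fˣ)) = symbol (fun j => residueUnitHom v (unitOfEqOne v (u j) (hu j)))) :
    D = boundary v hπ n :=
  hom_ext_primeUnitSymbols v hπ fun ϖ hϖ u hu => by rw [hD ϖ hϖ u hu, boundary_symbol_cons_units v hπ n hϖ u hu]

include hπ in
/-- **LEMMA 2.1.** «There exists one and only one homomorphism ∂ = ∂_v from K_nF to K_{n−1}F̄ which carries the product
l(π)l(u₂)⋯l(uₙ) to l(ū₂)⋯l(ūₙ) for every prime element π and for all units u₂, …, uₙ.» (Here from `K_{n+1}F` to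
`K_nF̄`, `n ≥ 0`; a field with a valuation possessing a prime element.) [cite: Milnor1970, §2 Lemma 2.1 (p0005 L36–L40)] -/
theorem existsUnique_boundary :
    ∃! D : MilnorK F (n + 1) →+ MilnorK (ValResidueField v) n,
      ∀ (ϖ : Fˣ), addVal v ϖ = 1 → ∀ (u : Fin n → Fˣ) (hu : ∀ j, addVal v (u j) = 0),
        D (symbol (Fin.cons ϖ u : Fin (n + 1) → Fˣ)) = symbol (fun j => residueUnitHom v (unitOfEqOne v (u j) (hu j))) :=
  ⟨boundary v hπ n, fun _ hϖ u hu => boundary_symbol_cons_units v hπ n hϖ u hu, fun D hD => boundary_unique v hπ D hD⟩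

/-- **`∂ = ∂_v` does not depend on the prime element used to construct it** («this homomorphism ψ is less natural than
∂, since it depends on a particular choice of π»). [cite: Milnor1970, §2 Lemma 2.1 (p0005 L36–L40), after Lemma 2.2 (p0007 L50–L51)] -/
theorem boundary_eq_boundary {π' : Fˣ} (hπ' : addVal v π' = 1) : boundary v hπ' n = boundary v hπ n :=
  boundary_unique v hπ _ fun _ hϖ u hu => boundary_symbol_cons_units v hπ' n hϖ u hu

end Generation

/-! ### §6 The Remarks: surjectivity, `n = 1` (`ord_v`) and `n = 2` (the tame symbol) -/

section LowDegrees

variable {n : ℕ}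

/-- **«Evidently ∂ is always surjective.»** [cite: Milnor1970, §2 Remarks (p0005 L42)] -/
theorem boundary_surjective : Function.Surjective (boundary v hπ n) := by
  intro z
  induction z using induction_on with
  | hsym k c =>
    -- lift the residues to units
    choose U hU using fun j => residueUnitHom_surjective v (c j)
    have hu : ∀ j, addVal v (U j : Fˣ) = 0 := fun j => addVal_coe_unitGroup v (U j)
    refine ⟨k • symbol (Fin.cons π (fun j => (U j : Fˣ)) : Fin (n + 1) → Fˣ), ?_⟩
    rw [map_zsmul, boundary_symbol_cons_units v hπ n hπ _ hu]
    congr 2; funext j; rw [← hU j]; rfl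
  | hadd x y hx hy =>
    obtain ⟨a, rfl⟩ := hx; obtain ⟨b, rfl⟩ := hy
    exact ⟨a + b, map_add _ a b⟩

/-- **`n = 1`: «the homomorphism ∂ can essentially be identified with the homomorphism ord_v : F• → ℤ»**: `∂{a} = v(a)`
in `K₀F̄ = ℤ`. [cite: Milnor1970, §2 Remarks (p0005 L42–L44)] -/
theorem zeroEquiv_boundary_symbol (a : Fin 1 → Fˣ) :
    zeroEquiv (ValResidueField v) (boundary v hπ 0 (symbol a)) = addVal v (a 0) := by
  rw [boundary_zero_symbol, map_zsmul, zeroEquiv_one, smul_eq_mul, _root_.mul_one]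

/-- «(For n = 1 the defining property is to be that ∂l(π) = 1.)» [cite: Milnor1970, §2 Lemma 2.1 (p0005 L40)] -/
theorem boundary_zero_symbol_prime {ϖ : Fˣ} (hϖ : addVal v ϖ = 1) : boundary v hπ 0 (symbol ![ϖ]) = one := by
  rw [boundary_zero_symbol, Matrix.cons_val_zero, hϖ, one_zsmul]

/-- **`n = 2`: «it is closely related to the classical "tame symbol"»** — precisely `∂{x, y} = l(d_v(y, x))` in
`K₁F̄ = F̄•`, with the book's `d_v(x, y) = (−1)^{v(x)v(y)} x^{v(y)}/y^{v(x)} mod 𝔓` (`tameSymbolOf v`).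
[cite: Milnor1970, §2 Remarks (p0006 L5–L7); Milnor1972, §11 Lemma 11.5] -/
theorem oneEquiv_boundary_symbol (x y : Fˣ) :
    oneEquiv (ValResidueField v) (boundary v hπ 1 (symbol ![x, y])) = Additive.ofMul (tameSymbolOf v y x) := by
  have hxy : symbol ![x, y] = cons x (symbol ![y]) := by rw [cons_symbol]; rfl
  have hy : (fun j => res v hπ ((![y] : Fin 1 → Fˣ) j)) = ![res v hπ y] := by
    funext j; rw [Fin.eq_zero j]; rfl
  rw [hxy, boundary_cons, boundary_zero_symbol, psi_one_symbol, hy, one, map_zsmul, cons_symbol, map_zsmul, cons_symbol]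
  simp only [map_sub, map_add, map_zsmul, oneEquiv_symbol, Fin.cons_zero, Matrix.cons_val_zero]
  -- the tame symbol through `res`
  rw [tameSymbolOf_def, ← res_of_addVal_eq_zero v hπ (addVal_tameUnit v y x), tameUnit]
  simp only [map_mul, map_inv, map_zpow, res_neg_one, ofMul_mul, ofMul_inv, ofMul_zpow]
  rw [mul_comm (addVal v y) (addVal v x), ← smul_smul]
  abel

end LowDegrees

/-! ### §7 LEMMA 2.2: `ψ` is a ring homomorphism `K_*F → K_*F̄`; uniqueness -/

section PsiRing

/-- `x ↦ x̄` commutes with appending tuples. [cite: Milnor1970, §2 Lemma 2.2 (p0007 L47–L49)] -/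
theorem res_comp_append {m n : ℕ} (a : Fin m → Fˣ) (b : Fin n → Fˣ) :
    (fun j => res v hπ (Fin.append a b j)) = Fin.append (fun j => res v hπ (a j)) (fun j => res v hπ (b j)) := by
  funext j
  refine Fin.addCases (fun i => ?_) (fun i => ?_) j
  · rw [Fin.append_left, Fin.append_left]
  · rw [Fin.append_right, Fin.append_right]

/-- **`ψ(1) = 1`.** [cite: Milnor1970, §2 Lemma 2.2 «ring homomorphism» (p0007 L39–L46)] -/
theorem psi_one' : psi v hπ 0 one = (one : MilnorK (ValResidueField v) 0) := psiZero_one v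

/-- **`ψ(ξη) = ψ(ξ)ψ(η)`** for the graded product `K_mF × K_nF → K_{m+n}F` of `MilnorKRing`. [cite: Milnor1970, §2 Lemma 2.2 «ring homomorphism ψ : K_*F → K_*F̄» (p0007 L39–L46)] -/
theorem psi_mul {m n : ℕ} (x : MilnorK F m) (y : MilnorK F n) :
    psi v hπ (m + n) (mul F m n x y) = mul (ValResidueField v) m n (psi v hπ m x) (psi v hπ n y) := by
  have h : (mul F m n).compr₂ (psi v hπ (m + n)) = ((mul (ValResidueField v) m n).comp (psi v hπ m)).compl₂ (psi v hπ n) :=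
    hom_ext₂ fun a b => by
      rw [AddMonoidHom.compr₂_apply, AddMonoidHom.compl₂_apply, AddMonoidHom.comp_apply, mul_symbol_symbol, psi_symbol,
        psi_symbol, psi_symbol, mul_symbol_symbol, res_comp_append]
  have := DFunLike.congr_fun (DFunLike.congr_fun h x) y
  rwa [AddMonoidHom.compr₂_apply, AddMonoidHom.compl₂_apply, AddMonoidHom.comp_apply] at this

/-- Degree-indexed families of homomorphisms commute with the degree identifications `K_p = K_q`.
[cite: Milnor1970, §1 «a graded ring K_*F = (K₀F, K₁F, K₂F, …)» (p0001 L30–L33)] -/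
theorem family_castEquiv {R S : Type*} [CommRing R] [CommRing S] (f : (n : ℕ) → MilnorK R n →+ MilnorK S n)
    {p q : ℕ} (h : p = q) (z : MilnorK R p) : f q (castEquiv h z) = castEquiv h (f p z) := by subst h; rfl

/-- **LEMMA 2.2, uniqueness**: «one and only one ring homomorphism ψ : K_*F → K_*F̄ which carries l(πⁱu) to l(ū) for
every unit u» — a unital family, multiplicative for the graded product, with `f{a} = {ā}` in degree `1`, is `ψ`.
[cite: Milnor1970, §2 Lemma 2.2 (p0007 L39–L46)] -/
theorem psi_unique (f : (n : ℕ) → MilnorK F n →+ MilnorK (ValResidueField v) n) (h0 : f 0 one = one)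
    (h1 : ∀ a : Fˣ, f 1 (symbol ![a]) = symbol ![res v hπ a])
    (hmul : ∀ {m n : ℕ} (x : MilnorK F m) (y : MilnorK F n), f (m + n) (mul F m n x y) = mul _ m n (f m x) (f n y))
    (n : ℕ) : f n = psi v hπ n := by
  refine hom_ext fun a => ?_
  rw [psi_symbol]
  induction n with
  | zero =>
    have ha : symbol a = one := congrArg symbol (funext fun j => Fin.elim0 j)
    have hb : symbol (fun j => res v hπ (a j)) = one := congrArg symbol (funext fun j => Fin.elim0 j)
    rw [ha, hb, h0]
  | succ n ih =>
    -- `{a} = cast({a₀}·{tail a})`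
    have hsplit : symbol a = castEquiv (Nat.add_comm 1 n) (mul F 1 n (symbol ![a 0]) (symbol (Fin.tail a))) := by
      rw [mul_symbol_symbol, castEquiv_symbol, Fin.append_left_eq_cons, Function.comp_assoc]
      simp only [Matrix.cons_val_zero, Fin.cons_self_tail]
      rw [show Fin.cast (Nat.add_comm 1 n) ∘ Fin.cast (Nat.add_comm 1 n).symm = id from funext fun i => Fin.ext rfl,
        Function.comp_id]
    have hsplit' : symbol (fun j => res v hπ (a j)) = castEquiv (Nat.add_comm 1 n)
        (mul (ValResidueField v) 1 n (symbol ![res v hπ (a 0)]) (symbol (fun j => res v hπ (Fin.tail a j)))) := by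
      rw [mul_symbol_symbol, castEquiv_symbol, Fin.append_left_eq_cons, Function.comp_assoc]
      simp only [Matrix.cons_val_zero]
      rw [show Fin.cast (Nat.add_comm 1 n) ∘ Fin.cast (Nat.add_comm 1 n).symm = id from funext fun i => Fin.ext rfl,
        Function.comp_id]
      congr 1; funext j; refine Fin.cases ?_ (fun k => ?_) j <;> rfl
    rw [hsplit, family_castEquiv f, hmul, h1, ih (Fin.tail a), hsplit']

end PsiRing

end MilnorK

end Literature.RingTheory.KTheory

end
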